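import Literature.NumberTheory.Automorphic.CongruenceSubgroupPropertySL2Lemma2
import Literature.NumberTheory.Automorphic.CongruenceSubgroupPropertySL2Symbol
import HarnessLib

/-!
# Serre's congruence subgroup property for `SL₂(𝓞_F)` — proofs, XV: Liehl's (8), (9), (10)

Topic `Literature/NumberTheory/Automorphic`; namespace `Literature.NumberTheory.Automorphic.SL2Rel`.
Everything here is PROVED; no definitions.

For the pair `(I₁, I₂) = (𝔮, A)`, `A = 𝓞 K` (`K` with a real place and a unit of infinite order):
**(8)** `[b over a] = [y²b over a]` for `a - 1 ∈ 𝔮y²` (`sym_sq_mul_eq`), **(9)**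
`α⁻¹ w⁻¹ α w ∈ E(I, I)` for `α ∈ G(I, I)` (`weyl_commutator_mem_relE`), **(10)**
`[dx over a] = [-ax over d]` for `x ∈ 𝔮`, `a - 1, d - 1 ∈ x²A`, `(a, d) = 1`
(`sym_mul_eq_sym_neg_mul`) — (8), (9) from Vaserstein's Lemma 2 (= Liehl (4)) and Lemma 1 (= (2))
exactly as printed, (10) by Mennicke's chain of (6) and (8) as printed.

## References

* [Liehl1981SL2Orders] B. Liehl, J. reine angew. Math. 323 (1981) 153–171, §3 (8), (9), (10).
* [Vaserstein1972SL2] L. N. Vaserstein, Mat. Sb. 89 (131) (1972) 313–322, Lemma 3.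
-/

open Matrix MatrixGroups NumberField

namespace Literature.NumberTheory.Automorphic

namespace SL2Rel

/-! ### Liehl's (8), (9), (10) over a ring of integers -/

section NumberField

variable {K : Type} [Field K] [NumberField K]

/-- Membership in `E(I₁, I₂)` can be tested in `SL₂(K)`. [folklore] -/
theorem mem_relE_of_map_mem {I₁ I₂ : Ideal (𝓞 K)} {M : SL(2, 𝓞 K)}
    (h : SpecialLinearGroup.map (algebraMap (𝓞 K) K) M ∈
      (relE I₁ I₂).map (SpecialLinearGroup.map (algebraMap (𝓞 K) K))) : M ∈ relE I₁ I₂ := by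
  obtain ⟨N, hN, hNM⟩ := Subgroup.mem_map.1 h
  rwa [← map_injective (algebraMap (𝓞 K) K) (IsFractionRing.injective (𝓞 K) K) hNM]

omit [NumberField K] in
/-- Conjugation by `g = diag(y, y⁻¹) ∈ SL₂(K)` maps `E(𝔮, y²A)` into `E(𝔮, A)` (`g E₁₂(x) g⁻¹ = E₁₂(y²x)`,
`g E₂₁(cy²) g⁻¹ = E₂₁(c)`). [cite: Liehl1981SL2Orders, §3 (8) (proof)] -/
theorem exists_relE_map_eq_diag_conj {𝔮 : Ideal (𝓞 K)} {y : 𝓞 K}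
    (hy : algebraMap (𝓞 K) K y ≠ 0) {M : SL(2, 𝓞 K)} (hM : M ∈ relE 𝔮 (Ideal.span {y * y})) :
    ∃ M' ∈ relE 𝔮 ⊤, SpecialLinearGroup.map (algebraMap (𝓞 K) K) M' =
      diagHom (Units.mk0 _ hy) * SpecialLinearGroup.map (algebraMap (𝓞 K) K) M *
        (diagHom (Units.mk0 _ hy))⁻¹ := by
  set f := algebraMap (𝓞 K) K with hf
  set g : SL(2, K) := diagHom (Units.mk0 _ hy) with hg
  refine Subgroup.closure_induction (p := fun M _ ↦ ∃ M' ∈ relE 𝔮 ⊤,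
    SpecialLinearGroup.map f M' = g * SpecialLinearGroup.map f M * g⁻¹) ?_ ?_ ?_ ?_ hM
  · rintro _ (⟨x, hx, rfl⟩ | ⟨c, hc, rfl⟩)
    · refine ⟨e12 (y * y * x), e12_mem_relE (𝔮.mul_mem_left _ hx), ?_⟩
      rw [map_e12, map_e12, hg, diagHom_conj_e12, Units.val_mk0, map_mul, map_mul]
    · rw [SetLike.mem_coe] at hc
      obtain ⟨c', rfl⟩ := Ideal.mem_span_singleton'.1 hc
      refine ⟨e21 c', e21_mem_relE Submodule.mem_top, ?_⟩
      rw [map_e21, map_e21, hg, diagHom_conj_e21, Units.val_inv_eq_inv_val, Units.val_mk0,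
        map_mul, map_mul]
      congr 1
      field_simp
  · exact ⟨1, one_mem _, by simp⟩
  · rintro M N - - ⟨M', hM', hM'eq⟩ ⟨N', hN', hN'eq⟩
    refine ⟨M' * N', mul_mem hM' hN', ?_⟩
    rw [map_mul, hM'eq, hN'eq, map_mul]; group
  · rintro M - ⟨M', hM', hM'eq⟩
    refine ⟨M'⁻¹, inv_mem hM', ?_⟩
    rw [map_inv, hM'eq, map_inv]; group

variable (hreal : ∃ w : InfinitePlace K, w.IsReal) (hunit : ∃ v : (𝓞 K)ˣ, ∀ n : ℕ, n ≠ 0 → v ^ n ≠ 1)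
include hreal hunit

/-- **Liehl (8)** for the pair `(𝔮, A)`: if `a - 1 ∈ 𝔮y²`, `b ∈ 𝔮`, `(a, b) = 1` then
`[b over a] = [y²b over a]`.  Proof as printed: `g = diag(y, y⁻¹)`; by (4) an ideal `I'` with
`β⁻¹gβg⁻¹ ∈ E(𝔮, A)` for `β ∈ G(I', I')`; complete `(a, b)` to `α ∈ G(𝔮, y²A)`, write `α = βε` by
(2); then `α⁻¹gαg⁻¹ ∈ E(𝔮, A)` and `gαg⁻¹` has first row `(a, y²b)`. [cite: Liehl1981SL2Orders, §3 (8)] -/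
theorem sym_sq_mul_eq {𝔮 : Ideal (𝓞 K)} (h𝔮 : 𝔮 ≠ ⊥) (y : 𝓞 K) {a b : 𝓞 K}
    (ha : a - 1 ∈ 𝔮 * Ideal.span {y * y}) (hb : b ∈ 𝔮) (hab : IsCoprime a b) :
    sym 𝔮 a (y * y * b) = sym 𝔮 a b := by
  by_cases hy0 : y = 0
  · have ha1 : a = 1 := by
      rw [hy0, mul_zero, Ideal.span_singleton_zero, Ideal.mul_bot, Ideal.mem_bot, sub_eq_zero] at ha
      exact ha
    rw [ha1, hy0, zero_mul, zero_mul, sym_one_zero, sym_one_left hb]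
  set f := algebraMap (𝓞 K) K with hf
  have hinj := map_injective f (IsFractionRing.injective (𝓞 K) K)
  have hy : f y ≠ 0 := fun h ↦ hy0 (IsFractionRing.injective (𝓞 K) K (by rw [h, map_zero]))
  set g : SL(2, K) := diagHom (Units.mk0 _ hy) with hg
  have ha𝔮 : a - 1 ∈ 𝔮 := Ideal.mul_le_right ha
  -- complete `(a, b)` to `α ∈ G(𝔮, y²A)`
  obtain ⟨α, hα, h0, h1⟩ := exists_relG_of_row ha hb hab
  set I : Ideal (𝓞 K) := 𝔮 * Ideal.span {y * y} with hI
  have hI0 : I ≠ ⊥ :=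
    mul_ne_zero h𝔮 (by rw [Ne, Ideal.zero_eq_bot, Ideal.span_singleton_eq_bot]; exact mul_ne_zero hy0 hy0)
  -- (4) for `g` and `I`; (2): `β = αε ∈ G(I', I')`
  obtain ⟨I', hI', hI'I, h4⟩ := exists_forall_relG_conj_mem hreal hunit g hI0
  obtain ⟨ε, hε, hβ⟩ := exists_mul_relE_mem_relG hI' (hI'I.trans Ideal.mul_le_right) hα
  -- `α⁻¹ g α g⁻¹ ∈ E(𝔮, A)` (inside `SL₂(K)`)
  set H := (relE 𝔮 ⊤).map (SpecialLinearGroup.map f) with hH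
  have hEI : relE I I ≤ relE 𝔮 ⊤ := relE_mono Ideal.mul_le_right le_top
  have hmem : (SpecialLinearGroup.map f α)⁻¹ * g * SpecialLinearGroup.map f α * g⁻¹ ∈ H := by
    obtain ⟨M₁, hM₁, hM₁eq⟩ := exists_relE_map_eq_diag_conj hy (inv_mem hε)
    rw [← hg] at hM₁eq
    have e : (SpecialLinearGroup.map f α)⁻¹ * g * SpecialLinearGroup.map f α * g⁻¹ =
        SpecialLinearGroup.map f ε *
          ((SpecialLinearGroup.map f (α * ε))⁻¹ * g * SpecialLinearGroup.map f (α * ε) * g⁻¹) *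
          (g * SpecialLinearGroup.map f ε⁻¹ * g⁻¹) := by
      rw [map_mul, map_inv]; group
    rw [e, ← hM₁eq]
    refine mul_mem (mul_mem (Subgroup.mem_map_of_mem _ (relE_mono le_rfl le_top hε)) ?_)
      (Subgroup.mem_map_of_mem _ hM₁)
    exact Subgroup.map_mono hEI (h4 _ hβ)
  obtain ⟨M₀, hM₀, hM₀eq⟩ := Subgroup.mem_map.1 hmem
  -- `g α g⁻¹` is the integral matrix `α' = (a, y²b; c/y², d)`
  obtain ⟨c', hc'⟩ := Ideal.mem_span_singleton'.1 hα.2.1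
  have hdet : a * α 1 1 - y * y * b * c' = 1 := by
    have := det_two α
    rw [h0, h1, ← hc'] at this
    linear_combination this
  set α' : SL(2, 𝓞 K) := ⟨!![a, y * y * b; c', α 1 1], by rw [Matrix.det_fin_two_of]; exact hdet⟩
    with hα'
  have hα'G : α' ∈ relG 𝔮 ⊤ := by
    refine ⟨𝔮.mul_mem_left _ hb, Submodule.mem_top, by rw [Ideal.mul_top]; exact ha𝔮, ?_⟩
    rw [Ideal.mul_top]
    exact Ideal.mul_le_right (hα.2.2.2 : α 1 1 - 1 ∈ 𝔮 * Ideal.span {y * y})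
  have hgα : SpecialLinearGroup.map f α' = g * SpecialLinearGroup.map f α * g⁻¹ := by
    obtain ⟨k00, k01, k10, k11⟩ := diagHom_conj_apply (Units.mk0 _ hy) (SpecialLinearGroup.map f α)
    rw [← hg] at k00 k01 k10 k11
    ext i j
    fin_cases i <;> fin_cases j <;> simp only [Fin.zero_eta, Fin.isValue, Fin.mk_one]
    · rw [k00, map_apply_two, map_apply_two, h0]; rfl
    · rw [k01, map_apply_two, map_apply_two, h1, Units.val_mk0]
      show f (y * y * b) = _
      rw [map_mul, map_mul]
    · rw [k10, map_apply_two, map_apply_two, ← hc', Units.val_inv_eq_inv_val, Units.val_mk0]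
      show f c' = _
      rw [map_mul, map_mul]; field_simp
    · rw [k11, map_apply_two, map_apply_two]; rfl
  have hαM : α' = α * M₀ := by
    apply hinj
    rw [hgα, map_mul, hM₀eq]; group
  -- conclude
  have hαG : α ∈ relG 𝔮 ⊤ := relG_mono le_rfl le_top hα
  rw [sym_eq_mk ⟨α', hα'G⟩ (a := a) (b := y * y * b) rfl rfl, sym_eq_mk ⟨α, hαG⟩ h0 h1]
  have e : (⟨α', hα'G⟩ : relG 𝔮 ⊤) = ⟨α, hαG⟩ * ⟨M₀, relE_le_relG _ _ hM₀⟩ := Subtype.ext hαM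
  rw [e]
  exact mk_mul_eq_of_mem_relE _ _ hM₀

/-- **Liehl (9)**: `α⁻¹ w⁻¹ α w ∈ E(I, I)` for `α ∈ G(I, I)`, `w = (0 -1; 1 0)` ("in the same
fashion" as (8): (4) for `w⁻¹`, (2), and `w⁻¹ E(I, I) w = E(I, I)`). [cite: Liehl1981SL2Orders, §3 (9)] -/
theorem weyl_commutator_mem_relE {I : Ideal (𝓞 K)} (hI : I ≠ ⊥) {α : SL(2, 𝓞 K)}
    (hα : α ∈ relG I I) : α⁻¹ * weylElt⁻¹ * α * weylElt ∈ relE I I := by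
  set f := algebraMap (𝓞 K) K with hf
  set h : SL(2, K) := SpecialLinearGroup.map f weylElt⁻¹ with hh
  obtain ⟨I', hI', hI'I, h4⟩ := exists_forall_relG_conj_mem hreal hunit h hI
  obtain ⟨ε, hε, hβ⟩ := exists_mul_relE_mem_relG hI' hI'I hα
  have e : α⁻¹ * weylElt⁻¹ * α * weylElt =
      ε * ((α * ε)⁻¹ * weylElt⁻¹ * (α * ε) * weylElt) * (weylElt⁻¹ * ε⁻¹ * weylElt) := by group
  rw [e]
  refine mul_mem (mul_mem hε ?_) (weylElt_inv_conj_mem_relE (inv_mem hε))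
  apply mem_relE_of_map_mem
  have := h4 _ hβ
  rw [hh, map_inv, inv_inv] at this
  simpa only [map_mul, map_inv] using this

/-- The chain of (6) and (8) in Mennicke's proof of (10): for `x ∈ 𝔮`, `a - 1 = x²s`,
`d - 1 ∈ x²A`, `d - a = x²e`, `(a, d) = 1`:
`[dx over a] = [dx over a'] = [x²b'' over a'] = [b'' over a'] = [b'' over d] = [xe over d]`,
`a' = a - sdx²`, `b'' = xe + sdx`. [cite: Liehl1981SL2Orders, §3 (10) (proof)] -/
theorem sym_mul_eq_sym_mul_aux {𝔮 : Ideal (𝓞 K)} (h𝔮 : 𝔮 ≠ ⊥) {x a d s e : 𝓞 K} (hx : x ∈ 𝔮)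
    (hs : a - 1 = x * x * s) (hd : d - 1 ∈ Ideal.span {x * x}) (he : d - a = x * x * e)
    (had : IsCoprime a d) : sym 𝔮 a (d * x) = sym 𝔮 d (x * e) := by
  have ha𝔮 : a - 1 ∈ 𝔮 := by rw [hs]; exact 𝔮.mul_mem_right _ (𝔮.mul_mem_right _ hx)
  have hd𝔮 : d - 1 ∈ 𝔮 :=
    (Ideal.span_singleton_le_iff_mem _).2 (𝔮.mul_mem_right _ hx) hd
  have hax : IsCoprime a x := ⟨1, -(x * s), by linear_combination hs⟩
  have hadx : IsCoprime a (d * x) := had.mul_right hax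
  have hdx : d * x ∈ 𝔮 := 𝔮.mul_mem_left _ hx
  set a' := a - s * d * x * x with ha'
  set b'' := x * e + s * d * x with hb''
  have hb''𝔮 : b'' ∈ 𝔮 := 𝔮.add_mem (𝔮.mul_mem_right _ hx) (𝔮.mul_mem_left _ hx)
  -- `[dx over a] = [dx over a']`
  have ha'𝔮 : a' - 1 ∈ 𝔮 := by
    rw [show a' - 1 = (a - 1) + (-(s * x)) * (d * x) by rw [ha']; ring]
    exact 𝔮.add_mem ha𝔮 (𝔮.mul_mem_left _ hdx)
  have ha'dx : IsCoprime a' (d * x) := by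
    rw [show a' = a + (d * x) * (-(s * x)) by rw [ha']; ring]
    exact hadx.add_mul_left_left _
  have h1 : sym 𝔮 a (d * x) = sym 𝔮 a' (d * x) := by
    rw [← sym_add_mul_left ha𝔮 hdx hadx (-(s * x)), ha']; ring_nf
  -- `[dx over a'] = [x²b'' over a']`
  have hkey : d * x = x * x * b'' + x * a' := by
    rw [hb'', ha']; linear_combination x * he
  have ha'b : IsCoprime a' (x * x * b'') := by
    rw [show x * x * b'' = d * x + a' * (-x) by rw [hkey]; ring]
    exact ha'dx.add_mul_left_right _
  have h2 : sym 𝔮 a' (d * x) = sym 𝔮 a' (x * x * b'') := by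
    rw [hkey]
    exact sym_add_mul_right ha'𝔮 (𝔮.mul_mem_left _ hb''𝔮) ha'b hx
  -- `[x²b'' over a'] = [b'' over a']` by (8)
  have ha'8 : a' - 1 ∈ 𝔮 * Ideal.span {x * x} := by
    rw [show a' - 1 = -(s * (d - 1)) * (x * x) by rw [ha']; linear_combination hs]
    exact Ideal.mul_mem_mul (𝔮.neg_mem (𝔮.mul_mem_left _ hd𝔮)) (Ideal.mem_span_singleton_self _)
  have h3 : sym 𝔮 a' (x * x * b'') = sym 𝔮 a' b'' :=
    sym_sq_mul_eq hreal hunit h𝔮 x ha'8 hb''𝔮 ha'b.of_mul_right_right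
  -- `[b'' over a'] = [b'' over d]` by (6): `d = a' + x b''`
  have h4 : sym 𝔮 a' b'' = sym 𝔮 d b'' := by
    rw [← sym_add_mul_left ha'𝔮 hb''𝔮 ha'b.of_mul_right_right x]
    congr 1
    rw [ha', hb'']; linear_combination -he
  -- `[b'' over d] = [xe over d]` by (6): `b'' = xe + (sx) d`
  have hdb : IsCoprime d b'' := by
    have : IsCoprime (a' + x * b'') b'' := ha'b.of_mul_right_right.add_mul_right_left x
    convert this using 1
    rw [ha', hb'']; linear_combination he
  have hdxe : IsCoprime d (x * e) := by
    rw [show x * e = b'' + d * (-(s * x)) by rw [hb'']; ring]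
    exact hdb.add_mul_left_right _
  have h5 : sym 𝔮 d b'' = sym 𝔮 d (x * e) := by
    rw [show b'' = x * e + (s * x) * d by rw [hb'']; ring]
    exact sym_add_mul_right hd𝔮 (𝔮.mul_mem_right _ hx) hdxe (𝔮.mul_mem_left _ hx)
  rw [h1, h2, h3, h4, h5]

/-- **Liehl (10)** for the pair `(𝔮, A)`: for `x ∈ 𝔮`, `a - 1, d - 1 ∈ x²A`, `(a, d) = 1`:
`[dx over a] = [-ax over d]`. [cite: Liehl1981SL2Orders, §3 (10)] -/
theorem sym_mul_eq_sym_neg_mul {𝔮 : Ideal (𝓞 K)} (h𝔮 : 𝔮 ≠ ⊥) {x a d : 𝓞 K} (hx : x ∈ 𝔮)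
    (ha : a - 1 ∈ Ideal.span {x * x}) (hd : d - 1 ∈ Ideal.span {x * x}) (had : IsCoprime a d) :
    sym 𝔮 a (d * x) = sym 𝔮 d (-(a * x)) := by
  obtain ⟨s, hs⟩ := Ideal.mem_span_singleton'.1 ha
  obtain ⟨s', hs'⟩ := Ideal.mem_span_singleton'.1 hd
  have he : d - a = x * x * (s' - s) := by linear_combination hs - hs'
  have he' : a - d = (-x) * (-x) * (-(s' - s)) := by linear_combination hs' - hs
  have h1 := sym_mul_eq_sym_mul_aux hreal hunit h𝔮 (x := x) (a := a) (d := d) (s := s)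
    (e := s' - s) hx (by linear_combination -hs) hd he had
  have h2 := sym_mul_eq_sym_mul_aux hreal hunit h𝔮 (x := -x) (a := d) (d := a) (s := s')
    (e := -(s' - s)) (𝔮.neg_mem hx) (by linear_combination -hs') (by rwa [neg_mul_neg]) he' had.symm
  rw [mul_neg, mul_neg, neg_mul, neg_neg] at h2
  rw [h1, h2]
  -- `[xe over d] = [xe over a]` by (6): `d = a + x (xe)`
  have ha𝔮 : a - 1 ∈ 𝔮 := by
    rw [← hs]; exact 𝔮.mul_mem_left _ (𝔮.mul_mem_right _ hx)
  have haxe : IsCoprime a (x * (s' - s)) := by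
    have h3 : IsCoprime a (d + a * (-1)) := had.add_mul_left_right _
    rw [show d + a * (-1) = x * (x * (s' - s)) by linear_combination he] at h3
    exact h3.of_mul_right_right
  rw [← sym_add_mul_left ha𝔮 (𝔮.mul_mem_right _ hx) haxe x]
  congr 1
  linear_combination he

end NumberField

end SL2Rel

end Literature.NumberTheory.Automorphic
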